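import Literature.NumberTheory.Automorphic.QuadraticHeckeCharacterCM
import Literature.NumberTheory.Automorphic.IdeleClassBaseChangePosReal
import Literature.NumberTheory.Automorphic.IdeleClassCharacterPrescribed
import HarnessLib

/-!
# `ε^m_{L/L⁺}` versus ∞-types `(z/|z|)^{e_w}`, and unitary Hecke characters of a CM field with prescribed
# restriction to `C_{L⁺}`

Topic `NumberTheory/Automorphic`; namespace `Literature.NumberTheory.Automorphic`. Theorems only (no definition, no
named fact, no instance).

Let `L` be a CM field, `L⁺` its maximal real subfield, `ι = classBaseChange L⁺ L : C_{L⁺} → C_L`,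
`ε = quadraticClassCharCM L : C_{L⁺} →ₜ* S¹` (`QuadraticHeckeCharacterCM.lean`), and for `e : (w ∣ ∞) → ℤ` let
`infinityTypeChar L e : L_∞ˣ →* S¹`, `u ↦ ∏_w (u_w/|u_w|)^{e_w}` (`UnitaryInfinityType.lean`).

* `extensionEmbedding_infiniteCompletionOfComap_of_isReal` — over a REAL place `v = w|_K`, the local base change
  `K_v → L_w` commutes with the embeddings into `ℂ` (both fix the canonical `ℝ`,
  `infiniteCompletionOfComap_realToCompletion`); `infLocalUnits_infiniteIdeleBaseChange_of_isReal` — the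
  `w`-component of `y_L` read in `ℂ` is the real number `y_v`.
* **`infinityTypeChar_infiniteIdeleBaseChange_of_isCMField`** — the PARITY COMPUTATION: if `e_w ≡ m (mod 2)` for
  all `w`, then for every `y ∈ L⁺_∞ˣ`, `∏_w ((y_L)_w/|(y_L)_w|)^{e_w} = ε[y]^m` (both sides are `∏_v sgn(y_v)^m`; the
  infinite places of `L` and `L⁺` correspond bijectively, Mathlib `IsCMField.equivInfinitePlace`).
* **`quadraticClassCharCM_zpow_compat`** — hence the compatibility hypothesis `hcompat` of
  `IdeleClassGroup.exists_ideleClassChar_of_isProperMap'` holds for `f = ι`, `χ_A = ε^m`, `e` as above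
  (`classBaseChange_compat_of_arch`, `IdeleClassBaseChangeInfinite.lean`).
* **`exists_ideleClassChar_of_isCMField`** — for every `m ∈ ℤ` and every `e` with `e_w ≡ m (mod 2)` there is a
  continuous unitary character `ψ : C_L →ₜ* S¹` of ∞-type `e` (`ψ[u] = ∏_w (u_w/|u_w|)^{e_w}` on `L_∞ˣ`) whose
  pull-back along `ι` is `ε^m`; `exists_ideleClassChar_of_isCMField_odd` — for `m` odd the pull-back is `ε` itself.
  All inputs are tree theorems: `isProperMap_classBaseChange` / `classBaseChange_injective` (proper, injective),
  `posRealToClass_range_le_range_classBaseChange_maximalRealSubfield` (positive reals come from `L⁺`), the parity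
  computation above, and the extension theorem `IdeleClassGroup.exists_ideleClassChar_of_isProperMap'`
  (`IdeleClassCharacterPrescribed.lean`, from divisibility of `S¹` and the openness of `K_∞ˣ × ∏ 𝒪_vˣ → C_K`).
  This is the standard existence statement for unitary Hecke characters of a CM field with prescribed components
  `(z/|z|)^{e_w}` at the complex places and prescribed restriction `ε^m_{L/L⁺}` to `𝔸ˣ_{L⁺}` (Weil, *Basic Number
  Theory*, Ch. VII §3 / Ch. XIII §1; used e.g. in PerL v5 §3.2, tex ll. 304–313, where it is asserted for
  `m_b ≡ m (mod 2)`).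

Provenance: tree-vocabulary form of the `pub-hodgecm` package files `HodgeCM/Literature/ClassBaseChangeParity.lean`
(CITED-FACT seat gen 5: `cmRealCoord`, `infLocalUnits_infBaseChange`, `harch_of_parity`,
`exists_unitaryHeckeCharacter_of_isCMField_parity`) and the N15 clauses of `QuadraticCharacterCM.lean` (gen 6:
`exists_unitaryHeckeCharacter_of_isCMField_zpow/_odd`), over the tree's `quadraticClassCharCM`, `infinityTypeChar`,
`classBaseChange` and `IdeleClassGroup.exists_ideleClassChar_of_isProperMap'`.

## References

* A. Weil, *Basic Number Theory* (1967), Ch. VII §3, Ch. XIII §1. [WeilBNT1967]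
* E. Hewitt, K. A. Ross, *Abstract Harmonic Analysis* I (1979), (24.12). [HewittRoss1979]
-/

noncomputable section

open NumberField NumberField.InfinitePlace NumberField.InfinitePlace.Completion

namespace Literature.NumberTheory.Automorphic

open GaloisRepresentations InfiniteAdeleRing Literature.Analysis.Complex

/-! ## Real places below: the local base change commutes with the embeddings into `ℂ` -/

section Real

variable (K L : Type) [Field K] [Field L] [Algebra K L]

/-- At a real place `v`, `realToCompletion K v` inverts `K_v ≃+* ℝ`. [folklore] -/
theorem realToCompletion_ringEquivRealOfIsReal {v : InfinitePlace K} (hv : v.IsReal) (x : v.Completion) :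
    realToCompletion K v (ringEquivRealOfIsReal hv x) = x :=
  (ringEquivRealOfIsReal hv).injective (ringEquivRealOfIsReal_realToCompletion K hv _)

/-- **Over a real place `v = w|_K`, `K_v → L_w` commutes with the embeddings into `ℂ`**:
`extensionEmbedding w (x_L) = extensionEmbedding v x`. [folklore] -/
theorem extensionEmbedding_infiniteCompletionOfComap_of_isReal (w : InfinitePlace L)
    (hv : (w.comap (algebraMap K L)).IsReal) (x : (w.comap (algebraMap K L)).Completion) :
    extensionEmbedding w (infiniteCompletionOfComap K L w x) = extensionEmbedding (w.comap (algebraMap K L)) x := by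
  conv_lhs => rw [← realToCompletion_ringEquivRealOfIsReal K hv x, infiniteCompletionOfComap_realToCompletion,
    extensionEmbedding_realToCompletion]
  rw [← extensionEmbeddingOfIsReal_apply hv, ringEquivRealOfIsReal_apply]

/-- The `w`-component of `y_L`, read in `ℂ`, is the real number `y_v` (`v = w|_K` real). [folklore] -/
theorem coe_infLocalUnits_infiniteIdeleBaseChange_of_isReal (w : InfinitePlace L)
    (hv : (w.comap (algebraMap K L)).IsReal) (y : (InfiniteAdeleRing K)ˣ) :
    ((infLocalUnits L w (infiniteIdeleBaseChange K L y) : ℂˣ) : ℂ) =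
      ((ringEquivRealOfIsReal hv ((y : InfiniteAdeleRing K) (w.comap (algebraMap K L))) : ℝ) : ℂ) := by
  rw [coe_infLocalUnits, infiniteIdeleBaseChange_apply, extensionEmbedding_infiniteCompletionOfComap_of_isReal K L w hv,
    ringEquivRealOfIsReal_apply, extensionEmbeddingOfIsReal_apply]

/-- The same as an identity in `ℂˣ`: the `w`-component of `y_L` is `ofRealUnits (y_v)`. [folklore] -/
theorem infLocalUnits_infiniteIdeleBaseChange_of_isReal (w : InfinitePlace L)
    (hv : (w.comap (algebraMap K L)).IsReal) (y : (InfiniteAdeleRing K)ˣ) :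
    infLocalUnits L w (infiniteIdeleBaseChange K L y) =
      ofRealUnits (Units.map (ringEquivRealOfIsReal hv : (w.comap (algebraMap K L)).Completion →* ℝ)
        (Units.map (evalRingHom K (w.comap (algebraMap K L))).toMonoidHom y)) :=
  Units.ext (by rw [coe_infLocalUnits_infiniteIdeleBaseChange_of_isReal K L w hv y, coe_ofRealUnits]; rfl)

end Real

/-! ## The CM case: `ε^m` versus the ∞-type `e`, `e_w ≡ m (mod 2)` -/

section CM

variable (L : Type) [Field L] [NumberField L] [IsCMField L]

local notation3 "L⁺" => maximalRealSubfield L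

omit [IsCMField L] in
/-- Every infinite place of `L⁺` is real; so is `w|_{L⁺}` for `w` an infinite place of `L`. [folklore] -/
theorem isReal_comap_maximalRealSubfield (w : InfinitePlace L) : (w.comap (algebraMap L⁺ L)).IsReal :=
  IsTotallyReal.isReal _

/-- The real coordinate `y_v ∈ ℝˣ` of `y ∈ L⁺_∞ˣ` at the (real) place `v`. Auxiliary abbreviation. [folklore] -/
abbrev cmRealCoord (y : (InfiniteAdeleRing L⁺)ˣ) (v : InfinitePlace L⁺) : ℝˣ :=
  Units.map (ringEquivRealOfIsReal (IsTotallyReal.isReal v) : v.Completion →* ℝ)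
    (Units.map (evalRingHom L⁺ v).toMonoidHom y)

omit [IsCMField L] in
/-- `cmRealCoord y v = ringEquivRealOfIsReal _ (y_v)` (definitional). [folklore] -/
theorem coe_cmRealCoord (y : (InfiniteAdeleRing L⁺)ˣ) (v : InfinitePlace L⁺) :
    ((cmRealCoord L y v : ℝˣ) : ℝ) = ringEquivRealOfIsReal (IsTotallyReal.isReal v) ((y : InfiniteAdeleRing L⁺) v) :=
  rfl

omit [IsCMField L] in
/-- The `w`-component of `y_L` is `ofRealUnits (y_{w|_{L⁺}})`. [folklore] -/
theorem infLocalUnits_infiniteIdeleBaseChange_of_isCMField (w : InfinitePlace L) (y : (InfiniteAdeleRing L⁺)ˣ) :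
    infLocalUnits L w (infiniteIdeleBaseChange L⁺ L y) = ofRealUnits (cmRealCoord L y (w.comap (algebraMap L⁺ L))) :=
  infLocalUnits_infiniteIdeleBaseChange_of_isReal L⁺ L w (isReal_comap_maximalRealSubfield L w) y

/-- `ε[y] = ∏_v (y_v/|y_v|)` in `S¹` for `y ∈ L⁺_∞ˣ`. [folklore] -/
theorem quadraticClassCharCM_infUnitsToClass_eq_prod (y : (InfiniteAdeleRing L⁺)ˣ) :
    quadraticClassCharCM L (infUnitsToClass L⁺ y) = ∏ v : InfinitePlace L⁺, unitPart (ofRealUnits (cmRealCoord L y v)) := by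
  apply Circle.ext
  rw [coe_quadraticClassCharCM_infUnitsToClass, ← Circle.coeHom_apply, map_prod]
  refine Finset.prod_congr rfl fun v _ => ?_
  rw [Circle.coeHom_apply]
  rcases lt_or_gt_of_ne (cmRealCoord L y v).ne_zero with h | h
  · have h' : ringEquivRealOfIsReal (IsTotallyReal.isReal v) ((y : InfiniteAdeleRing L⁺) v) < 0 := h
    rw [coe_unitPart_ofRealUnits_of_neg _ h, if_neg (not_lt.2 h'.le)]
  · have h' : 0 < ringEquivRealOfIsReal (IsTotallyReal.isReal v) ((y : InfiniteAdeleRing L⁺) v) := h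
    rw [unitPart_ofRealUnits_of_pos _ h, Circle.coe_one, if_pos h']

/-- **The parity computation.** If `e_w ≡ m (mod 2)` for every infinite place `w` of `L`, then for every
`y ∈ L⁺_∞ˣ`: `∏_w ((y_L)_w/|(y_L)_w|)^{e_w} = ε[y]^m`. [folklore] -/
theorem infinityTypeChar_infiniteIdeleBaseChange_of_isCMField (m : ℤ) (e : InfinitePlace L → ℤ)
    (he : ∀ w, e w ≡ m [ZMOD 2]) (y : (InfiniteAdeleRing L⁺)ˣ) :
    infinityTypeChar L e (infiniteIdeleBaseChange L⁺ L y) = quadraticClassCharCM L (infUnitsToClass L⁺ y) ^ m := by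
  rw [infinityTypeChar_apply, quadraticClassCharCM_infUnitsToClass_eq_prod, ← Finset.prod_zpow]
  -- reindex the product over the places of `L` by the places of `L⁺` (`w ↦ w|_{L⁺}` is a bijection)
  exact Fintype.prod_equiv (IsCMField.equivInfinitePlace L) _ _ fun w => by
    rw [infLocalUnits_infiniteIdeleBaseChange_of_isCMField, unitPart_ofRealUnits_zpow_congr _ (he w),
      IsCMField.equivInfinitePlace_apply]

/-- **`hcompat` for `f = ι`, `χ_A = ε^m`, `e ≡ m (mod 2)`**: `ι a = [u] ⇒ ε(a)^m = ∏_w (u_w/|u_w|)^{e_w}`. [folklore] -/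
theorem quadraticClassCharCM_zpow_compat (m : ℤ) (e : InfinitePlace L → ℤ) (he : ∀ w, e w ≡ m [ZMOD 2])
    (a : IdeleClassGroup L⁺) (u : (InfiniteAdeleRing L)ˣ)
    (h : classBaseChange (maximalRealSubfield L) L a = infUnitsToClass L u) :
    quadraticClassCharCM L a ^ m = infinityTypeChar L e u :=
  classBaseChange_compat_of_arch L⁺ L (fun a => quadraticClassCharCM L a ^ m) (infinityTypeChar L e)
    (fun y => (infinityTypeChar_infiniteIdeleBaseChange_of_isCMField L m e he y).symm) a u h

/-! ## Unitary idèle class characters of `L` with pull-back `ε^m` and ∞-type `e` -/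

/-- **Unitary Hecke characters of a CM field with prescribed ∞-type and restriction `ε^m` to `C_{L⁺}`.** For every
`m ∈ ℤ` and every `e : (w ∣ ∞) → ℤ` with `e_w ≡ m (mod 2)` there is a continuous unitary character
`ψ : C_L →ₜ* S¹` with `ψ[u] = ∏_w (u_w/|u_w|)^{e_w}` on `L_∞ˣ` and `ψ ∘ ι = ε^m` on `C_{L⁺}`.
[cite: WeilBNT1967, Ch. VII §3] -/
theorem exists_ideleClassChar_of_isCMField (m : ℤ) (e : InfinitePlace L → ℤ) (he : ∀ w, e w ≡ m [ZMOD 2]) :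
    ∃ ψ : IdeleClassGroup L →ₜ* Circle, IdeleClassGroup.HasInfinityType L ψ e ∧
      ∀ a : IdeleClassGroup L⁺, ψ (classBaseChange (maximalRealSubfield L) L a) = quadraticClassCharCM L a ^ m := by
  have h := IdeleClassGroup.exists_ideleClassChar_of_isProperMap' L (classBaseChange (maximalRealSubfield L) L)
    (isProperMap_classBaseChange _ _) ((zpowGroupHom m).comp (quadraticClassCharCM L).toMonoidHom)
    ((continuous_zpow m).comp (quadraticClassCharCM L).continuous)
    (fun a ha => by
      rw [classBaseChange_eq_one_iff] at ha
      rw [ha, map_one])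
    e (fun a u hau => quadraticClassCharCM_zpow_compat L m e he a u hau)
    (posRealToClass_range_le_range_classBaseChange_maximalRealSubfield L)
  exact h

/-- **Odd `m`: pull-back `ε` itself** (`ε^m = ε` as `ε² = 1`). [cite: WeilBNT1967, Ch. VII §3] -/
theorem exists_ideleClassChar_of_isCMField_odd {m : ℤ} (hm : Odd m) (e : InfinitePlace L → ℤ)
    (he : ∀ w, e w ≡ m [ZMOD 2]) :
    ∃ ψ : IdeleClassGroup L →ₜ* Circle, IdeleClassGroup.HasInfinityType L ψ e ∧
      ∀ a : IdeleClassGroup L⁺, ψ (classBaseChange (maximalRealSubfield L) L a) = quadraticClassCharCM L a := by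
  obtain ⟨ψ, hψ, hres⟩ := exists_ideleClassChar_of_isCMField L m e he
  refine ⟨ψ, hψ, fun a => ?_⟩
  rw [hres a]
  have h1 : m ≡ 1 [ZMOD 2] := by
    obtain ⟨k, rfl⟩ := hm
    exact Int.ModEq.symm ((Int.modEq_iff_dvd).2 ⟨-k, by ring⟩) |>.symm
  rw [zpow_eq_zpow_of_sq_eq_one_of_modEq (quadraticClassCharCM_sq a) h1, zpow_one]

/-- **Even ∞-types: a character of ∞-type `e` trivial on `ι(C_{L⁺})`** (`m = 0`). [cite: WeilBNT1967, Ch. VII §3] -/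
theorem exists_ideleClassChar_of_isCMField_even (e : InfinitePlace L → ℤ) (he : ∀ w, Even (e w)) :
    ∃ ψ : IdeleClassGroup L →ₜ* Circle, IdeleClassGroup.HasInfinityType L ψ e ∧
      ∀ a : IdeleClassGroup L⁺, ψ (classBaseChange (maximalRealSubfield L) L a) = 1 := by
  obtain ⟨ψ, hψ, hres⟩ := exists_ideleClassChar_of_isCMField L 0 e fun w => by
    obtain ⟨k, hk⟩ := he w
    exact (Int.modEq_iff_dvd).2 ⟨-k, by rw [hk]; ring⟩
  exact ⟨ψ, hψ, fun a => by rw [hres a, zpow_zero]⟩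

end CM

end Literature.NumberTheory.Automorphic

end
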